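import Summits.Ventures.HodgeRepro2.T5HeckeTranspose
import Summits.Ventures.HodgeRepro2.T5HeckeConvolutionAlgebra

/-!
# Gelfand's trick for the Hecke algebra `H(G, K)` — inversion form

Kernel annex of the Tier-5 record (blind lane).  The record's sentence
«for `K` hyperspecial the Hecke algebra `H(G, K)` is commutative (Satake)» enters the kernel
files of this seat only as a hypothesis (`T5HeckeCommutativeMultiplicityOne`).  This file
records the elementary half of the classical proof of that commutativity — *Gelfand's trick* —
in the Haar-measure-free model `H(G, K) = End_G(k[G/K]) ≃ k[G/K]^K` of `T5HeckePermutationModule`: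

* if every double coset is stable under inversion, `K g⁻¹ K = K g K` for all `g` (stated in the
  orbit form `↑g⁻¹ ∈ K • (gK)` in `G ⧸ K`), then the anti-involution `t ↦ t^∨` of
  `T5HeckeTranspose` is the identity on `k[G/K]^K` (`transpose_eq_self_of_inv_mem_orbit`);
* since `(t ∗ s)^∨ = s^∨ ∗ t^∨` (`T5HeckeTranspose.transpose_conv`), the convolution is then
  commutative (`conv_comm_of_transpose_eq`, `conv_comm_of_inv_mem_orbit`), and so is the
  Hecke algebra `H(G, K)` itself (`mul_comm_of_inv_mem_orbit`, through `transposeOp`).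

What stays prose: that the double cosets of a *specific* hyperspecial `K` are inversion-stable
(the Cartan decomposition `G = ⊔ K λ(ϖ) K` together with `-1` in the relative Weyl group), and the
printed theorems.  The general anti-automorphism form (needed for `GL_n`, where inversion alone does
not preserve the double cosets) is `T5HeckeGelfandTrickGeneral`.
-/

namespace Summit.Ventures.HodgeRepro2.T5HeckeGelfandTrick

open T5HeckePermutationModule T5HeckeConvolution T5HeckeTranspose LevelPositivity

variable {G : Type*} [Group G] {k : Type*} [Field k] {K : Subgroup G}

/-! The double-coset condition of Gelfand's trick is carried as an explicit hypothesis
`hinv : ∀ g : G, ((g⁻¹ : G) : G ⧸ K) ∈ MulAction.orbit K ((g : G) : G ⧸ K)` — `g⁻¹ ∈ K g K` for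
every `g`, in the orbit form «the coset `g⁻¹K` lies in the `K`-orbit of `gK` in `G ⧸ K`»
(no definition is introduced: the file stays in the proof lane). -/

/-- Membership of `x⁻¹K` in the `K`-orbit of `gK` means `x⁻¹ = κ₁ g κ₂` with `κ₁ ∈ K`, `κ₂ ∈ K`:
the orbit form of the double-coset condition is the set form `g⁻¹ ∈ K g K`. -/
theorem mem_orbit_iff_exists_mul_mul (x g : G) :
    ((x : G) : G ⧸ K) ∈ MulAction.orbit K ((g : G) : G ⧸ K) ↔
      ∃ κ₁ ∈ K, ∃ κ₂ ∈ K, x = κ₁ * g * κ₂ := by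
  constructor
  · rintro ⟨⟨κ, hκ⟩, hx⟩
    have h : ((κ * g : G) : G ⧸ K) = (x : G ⧸ K) := hx
    rw [QuotientGroup.eq] at h
    refine ⟨κ, hκ, (κ * g)⁻¹ * x, h, ?_⟩
    group
  · rintro ⟨κ₁, h₁, κ₂, h₂, rfl⟩
    refine ⟨⟨κ₁, h₁⟩, ?_⟩
    change ((κ₁ * g : G) : G ⧸ K) = ((κ₁ * g * κ₂ : G) : G ⧸ K)
    rw [QuotientGroup.eq]
    have e : (κ₁ * g)⁻¹ * (κ₁ * g * κ₂) = κ₂ := by group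
    rwa [e]

/-- The double-coset condition is the set-theoretic statement `K g⁻¹ K = K g K` for every `g`,
read as equality of `K`-orbits in `G ⧸ K`. -/
theorem forall_inv_mem_orbit_iff_orbit_eq :
    (∀ g : G, ((g⁻¹ : G) : G ⧸ K) ∈ MulAction.orbit K ((g : G) : G ⧸ K)) ↔
      ∀ g : G, MulAction.orbit K ((g⁻¹ : G) : G ⧸ K) = MulAction.orbit K ((g : G) : G ⧸ K) := by
  simp only [MulAction.orbit_eq_iff]

/-- Under the double-coset condition the anti-involution `t ↦ t^∨` fixes every `K`-invariant
element of `k[G/K]`: coefficientwise `t^∨(xK) = t(x⁻¹K) = t(xK)` because `x⁻¹K` lies in the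
`K`-orbit of `xK` and `t` is constant on `K`-orbits. -/
theorem transpose_eq_self_of_inv_mem_orbit (hK : ∀ g : G, Finite (MulAction.orbit K (g : G ⧸ K)))
    (hinv : ∀ g : G, ((g⁻¹ : G) : G ⧸ K) ∈ MulAction.orbit K ((g : G) : G ⧸ K)) {t : MonoidAlgebra k (G ⧸ K)}
    (ht : t ∈ invariants (Representation.ofMulAction k G (G ⧸ K)) K) :
    transpose hK t = t := by
  apply MonoidAlgebra.ext
  apply Finsupp.ext
  intro x
  induction x using QuotientGroup.induction_on with
  | H x =>
    rw [coeff_transpose_mk hK ht x]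
    exact T5HeckeDoubleCosetBasis.coeff_eq_of_mem_orbit ht (hinv x)

/-- Gelfand's trick, abstract form: if the anti-involution `t ↦ t^∨` is the identity on
`k[G/K]^K`, the convolution of `K`-invariants is commutative:
`t ∗ s = (t ∗ s)^∨ = s^∨ ∗ t^∨ = s ∗ t`. -/
theorem conv_comm_of_transpose_eq (hK : ∀ g : G, Finite (MulAction.orbit K (g : G ⧸ K)))
    (hfix : ∀ t ∈ invariants (Representation.ofMulAction k G (G ⧸ K)) K, transpose hK t = t)
    {t s : MonoidAlgebra k (G ⧸ K)}
    (ht : t ∈ invariants (Representation.ofMulAction k G (G ⧸ K)) K)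
    (hs : s ∈ invariants (Representation.ofMulAction k G (G ⧸ K)) K) :
    conv t s = conv s t := by
  calc conv t s = transpose hK (conv t s) := (hfix _ (conv_mem_invariants ht hs)).symm
    _ = conv (transpose hK s) (transpose hK t) := transpose_conv hK ht hs
    _ = conv s t := by rw [hfix s hs, hfix t ht]

/-- Gelfand's trick, convolution form: inversion-stable double cosets force the convolution of
`K`-invariants to be commutative. -/
theorem conv_comm_of_inv_mem_orbit (hK : ∀ g : G, Finite (MulAction.orbit K (g : G ⧸ K)))
    (hinv : ∀ g : G, ((g⁻¹ : G) : G ⧸ K) ∈ MulAction.orbit K ((g : G) : G ⧸ K)) {t s : MonoidAlgebra k (G ⧸ K)}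
    (ht : t ∈ invariants (Representation.ofMulAction k G (G ⧸ K)) K)
    (hs : s ∈ invariants (Representation.ofMulAction k G (G ⧸ K)) K) :
    conv t s = conv s t :=
  conv_comm_of_transpose_eq hK (fun _ ht' => transpose_eq_self_of_inv_mem_orbit hK hinv ht') ht hs

/-- Under the double-coset condition the anti-involution `transposeOp` of `H(G, K)` is the
identity: both sides take the value `(T δ_K)^∨ = T δ_K` at `δ_K`. -/
theorem transposeOp_eq_self_of_inv_mem_orbit
    (hK : ∀ g : G, Finite (MulAction.orbit K (g : G ⧸ K)))
    (hinv : ∀ g : G, ((g⁻¹ : G) : G ⧸ K) ∈ MulAction.orbit K ((g : G) : G ⧸ K)) (T : heckeAlgebra k K) :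
    transposeOp hK T = T := by
  apply ext_of_apply_single_one
  rw [transposeOp_apply_single_one]
  exact transpose_eq_self_of_inv_mem_orbit hK hinv (apply_single_one_mem_invariants T)

/-- Gelfand's trick for `H(G, K) = End_G(k[G/K])`: if the anti-involution `transposeOp` is the
identity, the algebra is commutative: `T S = (T S)^∨ = S^∨ T^∨ = S T`. -/
theorem mul_comm_of_transposeOp_eq (hK : ∀ g : G, Finite (MulAction.orbit K (g : G ⧸ K)))
    (hfix : ∀ T : heckeAlgebra k K, transposeOp hK T = T) (T S : heckeAlgebra k K) :
    T * S = S * T := by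
  calc T * S = transposeOp hK (T * S) := (hfix _).symm
    _ = transposeOp hK S * transposeOp hK T := transposeOp_mul hK T S
    _ = S * T := by rw [hfix S, hfix T]

/-- **Gelfand's trick** (inversion form).  If `g⁻¹ ∈ K g K` for every `g ∈ G` and every
`K g K / K` is finite, the Hecke algebra `H(G, K)` is commutative. -/
theorem mul_comm_of_inv_mem_orbit (hK : ∀ g : G, Finite (MulAction.orbit K (g : G ⧸ K)))
    (hinv : ∀ g : G, ((g⁻¹ : G) : G ⧸ K) ∈ MulAction.orbit K ((g : G) : G ⧸ K)) (T S : heckeAlgebra k K) : T * S = S * T :=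
  mul_comm_of_transposeOp_eq hK (transposeOp_eq_self_of_inv_mem_orbit hK hinv) T S

/-- The double-coset operators commute under the double-coset condition:
`T_g T_h = T_h T_g` (the special case of `mul_comm_of_inv_mem_orbit` on the basis of `H(G, K)`). -/
theorem doubleCosetOp_mul_comm (hK : ∀ g : G, Finite (MulAction.orbit K (g : G ⧸ K)))
    (hinv : ∀ g : G, ((g⁻¹ : G) : G ⧸ K) ∈ MulAction.orbit K ((g : G) : G ⧸ K)) (g h : G) :
    haveI := hK g; haveI := hK h
    T5HeckeDoubleCoset.doubleCosetOp k K g * T5HeckeDoubleCoset.doubleCosetOp k K h =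
      T5HeckeDoubleCoset.doubleCosetOp k K h * T5HeckeDoubleCoset.doubleCosetOp k K g :=
  mul_comm_of_inv_mem_orbit hK hinv _ _

/-- Conversely, commutativity of `H(G, K)` is *equivalent* to `transposeOp` being the identity
when `transposeOp` is known to be an anti-automorphism fixing the basis — here only the
direction used by the record is stated: `transposeOp` fixes `T_g` iff `K g⁻¹ K = K g K`. -/
theorem transposeOp_doubleCosetOp_eq_self_iff
    (hK : ∀ g : G, Finite (MulAction.orbit K (g : G ⧸ K))) (g : G) :
    haveI := hK g; haveI := hK g⁻¹
    transposeOp hK (T5HeckeDoubleCoset.doubleCosetOp k K g) =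
        T5HeckeDoubleCoset.doubleCosetOp k K g ↔
      ((g⁻¹ : G) : G ⧸ K) ∈ MulAction.orbit K ((g : G) : G ⧸ K) := by
  haveI := hK g; haveI := hK g⁻¹
  rw [transposeOp_doubleCosetOp hK g, ← MulAction.orbit_eq_iff]
  constructor
  · intro h
    have h1 := congrArg (fun T : heckeAlgebra k K => (T : Module.End k (MonoidAlgebra k (G ⧸ K)))
      (MonoidAlgebra.single ((1 : G) : G ⧸ K) (1 : k))) h
    simp only [T5HeckeDoubleCoset.doubleCosetOp_apply_single_one] at h1
    have h2 := congrArg MonoidAlgebra.coeff h1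
    ext y
    have hy := congrArg (fun f : G ⧸ K →₀ k => f y) h2
    simp only [T5HeckeDoubleCosetBasis.coeff_orbitVector k K (Set.toFinite _)] at hy
    by_cases hy1 : y ∈ MulAction.orbit K ((g⁻¹ : G) : G ⧸ K)
    · have : y ∈ MulAction.orbit K ((g : G) : G ⧸ K) := by
        by_contra hy2
        rw [Set.indicator_of_mem hy1, Set.indicator_of_notMem hy2] at hy
        exact one_ne_zero hy
      exact ⟨fun _ => this, fun _ => hy1⟩
    · have : y ∉ MulAction.orbit K ((g : G) : G ⧸ K) := by
        intro hy2
        rw [Set.indicator_of_notMem hy1, Set.indicator_of_mem hy2] at hy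
        exact zero_ne_one hy
      exact ⟨fun h' => absurd h' hy1, fun h' => absurd h' this⟩
  · intro h
    exact T5HeckeDoubleCoset.doubleCosetOp_eq_of_orbit_eq k K h

end Summit.Ventures.HodgeRepro2.T5HeckeGelfandTrick
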